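import Summits.BirchSwinnertonDyer.BirchSwinnertonDyer.Theorems.GenusKolyvaginAtTwoPowDvdShaCardAtTwoRTLocalEigenDuality
import Summits.BirchSwinnertonDyer.BirchSwinnertonDyer.Theorems.GenusKolyvaginAtTwoPowDvdShaCardAtTwoRTLocalConjInvariance
import Summits.BirchSwinnertonDyer.BirchSwinnertonDyer.Theorems.GenusKolyvaginAtTwoPowDvdShaCardAtTwoRTUnramifiedParametrization
import Summits.BirchSwinnertonDyer.BirchSwinnertonDyer.Theorems.GenusKolyvaginAtTwoPowDvdShaCardAtTwoRTRegularFrameAtTwo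
import HarnessLib

/-!
# Route `GenusKolyvaginAtTwo`, crux U_T `ShaCardDvdPowAtTwoRT` (stmt-BirchSwinnertonDyer-23298; upper half
# `#Ш(E/K)[2^∞] ∣ 2^(2M₀)`) — THE BOTTOM-LAYER LOCAL VANISHING LAW: at a deep inert Kolyvagin place of the Heegner field a Kummer class that is
# `τ`-fixed and `2`-torsion MODULO `q·𝓛` pairs trivially with every `±`-eigen local class killed by `q`

Seat `bsd-line-gk2-p3` g25 (PROVER seat 3/3, cell `bsd-f1-sign2`), `--supports stmt-BirchSwinnertonDyer-23298` (helper; closes nothing).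
THEOREMS ONLY (no definition, no named fact, no `sorry`); follows gk2-p4 g20's `…RTCrossSignLocalVanishing` (p736279) line by line, replacing
«`(−s)`-eigen modulo `q`» by «`τ`-fixed and `2`-torsion modulo `q`».  BSD is NOT proved by any of this; neither is U_T, L_T nor any stub.

WHY (seat memo `Cruxes/ShaCardDvdPowAtTwoRT/Lines/norm-sharp-upper-gk2p3.md` §3; the pure-algebra case `q = 2` is
`…ShaCardDvdPowAtTwoRTBottomLayerInvisible`, p740653).  McCallum's Prop. 4.7 writes the level-`m` Cassels–Tate value `B(x, y)` of a Kolyvagin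
Ш-class `x = ι(m·b₁)` against `y` as a sum of local terms `inv_λ(loc_λ b₁ ∪ₑ β′_λ)` over the own places `λ` of `b₁`, with `β′_λ ∈ 𝓛_λ^{(m²)}` a
Kummer lift of the level-`m` class of `y`, known only MODULO `ker [m]_* ∩ 𝓛 = m·𝓛`.  When `y` lies in the bottom layer from `ℚ` (its lift is
`τ`-invariant and `2`-torsion) `β′_λ` is `τ`-fixed and `2`-torsion modulo `m·𝓛_λ`; this file proves that such a Kummer class pairs to ZERO with
the (eigen) localisation of `b₁` on the REGULAR frame (`E[2^M]` free of rank one over `ℤ/2^M[τ̃_*]`, `Δ < 0`): in coordinates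
`β′ = a·a₀ + b·τa₀` the relations give `b − a, 2a ∈ qℤ + 2^Mℤ`, so the norm coefficient `a ± b ∈ qℤ + 2^Mℤ` kills `P(a₀, loc b₁)`.
The sequel `…ShaCardDvdPowAtTwoRTBottomLayerOrthogonal` turns this into `B(x, y) = 0`.
* §1 `pairing_eq_zero_of_tau_sub_eq_zsmul_of_two_smul_eq_zsmul` — abstract law (free rank-one `ℤ/2^M[τ]`-module, invariant pairing):
  `τw − w = q·w₁`, `2w = q·w₂`, `σy = ±y`, `q·y = 0` ⟹ `P(w, y) = 0`.
* §2 `invWeilPairing_kummer_eq_zero_of_conj_sub_eq_zsmul_of_two_smul_eq_zsmul` (+ `_right`) — displayed local structure.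
* §3 `invWeilPairing_kummer_localization_eq_zero_of_conjActPlace_sub_eq_zsmul_of_two_smul` (+ `_of_level_eq`) — assembled at a deep inert
  Kolyvagin place (no displayed local structure left).

References: [McCallumLMS1991] §4 Prop. 4.7, §5 Lemma 5.3, Thm. 5.4; [MilneADT2006] I §6 proof of Prop. 6.9, I Cor. 2.3; [GrossLMS1991] §3 (3.2),
Prop. 5.4; [Howard2004HeegnerKolyvagin] Lemma 1.5.3.
-/

set_option autoImplicit false

noncomputable section

open scoped Classical
open scoped AddSubgroup
open Function Field NumberField IsDedekindDomain WeierstrassCurve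
open Literature.NumberTheory.EllipticCurves Literature.NumberTheory.GaloisRepresentations
open Literature.NumberTheory.GaloisCohomology
open Literature.NumberTheory.Automorphic
open Summit.BirchSwinnertonDyer.Rank1Residual.X11b.Relaxation
open Summit.BirchSwinnertonDyer.Rank1Residual.JET.GlobalDuality

-- the Theorems namespace of this sub repeats the summit name by design (D-0017 nested layout)
set_option linter.dupNamespace false

namespace Summit.BirchSwinnertonDyer.BirchSwinnertonDyer.Theorems.GenusExact.PlusDescent

/-! ## §1 The abstract law: `τ`-fixed and `2`-torsion modulo `q` pairs trivially with `±`-eigenvectors killed by `q` -/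

section Law

variable {A B R : Type*} [AddCommGroup A] [AddCommGroup B] [AddCommGroup R]
  (τ : A →+ A) (hτ : ∀ x, τ (τ x) = x) (σ : B →+ B) (hσ : ∀ y, σ (σ y) = y)
  (P : A →+ B →+ R) (hinv : ∀ x y, P (τ x) (σ y) = P x y)
  {M : ℕ} (a₀ : A)
  (hspan : ∀ Q : A, ∃ a b : ℤ, Q = a • a₀ + b • τ a₀)
  (hfree : ∀ a b : ℤ, a • a₀ + b • τ a₀ = 0 → (2 ^ M : ℤ) ∣ a ∧ (2 ^ M : ℤ) ∣ b)
  (htor : (2 ^ M : ℤ) • a₀ = 0)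

include hτ hσ hinv hspan hfree htor in
/-- **`τ`-fixed and `2`-torsion modulo `q` ⟹ orthogonal to every `±`-eigenvector killed by `q`.**  `P : A × B → R` bi-additive with
`P(τa, σb) = P(a, b)`, `A` free of rank one over `ℤ/2^M[τ]` on `a₀`, any `q`.  If `τw − w = q·w₁` and `2·w = q·w₂` (the `A`-side vector is
FIXED and `2`-TORSION MODULO `q`), `σy = s·y` (`s = ±1`) and `q·y = 0`, then `P(w, y) = 0`: in coordinates `w = a·a₀ + b·τa₀` one has
`b − a ∈ qℤ + 2^Mℤ` and `2a ∈ qℤ + 2^Mℤ`, so `P(w, y) = (a + sb)·P(a₀, y)` with `a + sb ∈ qℤ + 2^Mℤ` — and both `q` and `2^M` kill `P(a₀, y)`.  For `q = 2`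
(`M ≥ 1`) and `w₁ = w₂ = …` this is `…BottomLayerInvisible.pairing_eq_zero_of_two_smul_eq_zero_of_fixed`; the modulo-`q` form is what
McCallum's Prop. 4.7 needs (the Kummer lift `β′_λ` is known only modulo `ker [m]_* ∩ 𝓛 = m·𝓛`). [cite: McCallumLMS1991, §4 Prop. 4.7, §5 Lemma 5.3] -/
theorem pairing_eq_zero_of_tau_sub_eq_zsmul_of_two_smul_eq_zsmul {s q : ℤ} (hs : s = 1 ∨ s = -1)
    {w w₁ w₂ : A} (hw1 : τ w - w = q • w₁) (hw2 : (2 : ℤ) • w = q • w₂) {y : B} (hy : σ y = s • y) (hqy : q • y = 0) :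
    P w y = 0 := by
  obtain ⟨a, b, rfl⟩ := hspan w
  obtain ⟨c, d, hw₁⟩ := hspan w₁
  obtain ⟨c', d', hw₂⟩ := hspan w₂
  -- the two relations in coordinates
  have hrel1 : (b - a - q * c) • a₀ + (a - b - q * d) • τ a₀ = 0 := by
    have h : τ (a • a₀ + b • τ a₀) - (a • a₀ + b • τ a₀) - q • w₁ = 0 := by rw [hw1, sub_self]
    rw [hw₁, map_add, map_zsmul, map_zsmul, hτ] at h
    rw [← h]
    module
  have hrel2 : (2 * a - q * c') • a₀ + (2 * b - q * d') • τ a₀ = 0 := by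
    have h : (2 : ℤ) • (a • a₀ + b • τ a₀) - q • w₂ = 0 := by rw [hw2, sub_self]
    rw [hw₂] at h
    rw [← h]
    module
  obtain ⟨⟨k₁, hk₁⟩, -⟩ := hfree _ _ hrel1
  obtain ⟨⟨k₂, hk₂⟩, -⟩ := hfree _ _ hrel2
  -- the value `(a + s b) • P a₀ y`
  have hval : P (a • a₀ + b • τ a₀) y = (a + s * b) • P a₀ y := by
    rw [map_add, map_zsmul, map_zsmul, AddMonoidHom.add_apply, AddMonoidHom.zsmul_apply, AddMonoidHom.zsmul_apply,
      pairing_tau_left_of_invariant τ σ hσ P hinv, hy, map_zsmul, smul_smul, ← add_zsmul, mul_comm b s]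
  have hqP : q • P a₀ y = 0 := by rw [← map_zsmul, hqy, map_zero]
  have hMP : (2 ^ M : ℤ) • P a₀ y = 0 := two_pow_zsmul_pairing_basis_eq_zero P a₀ htor y
  rw [hval]
  rcases hs with rfl | rfl
  · have hab : a + 1 * b = q * (c + c') + 2 ^ M * (k₁ + k₂) := by linear_combination hk₁ + hk₂
    rw [hab, add_zsmul, mul_comm q, mul_comm (2 ^ M : ℤ), mul_zsmul, mul_zsmul, hqP, hMP, zsmul_zero, zsmul_zero, add_zero]
  · have hab : a + (-1) * b = q * (-c) + 2 ^ M * (-k₁) := by linear_combination (-1 : ℤ) * hk₁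
    rw [hab, add_zsmul, mul_comm q, mul_comm (2 ^ M : ℤ), mul_zsmul, mul_zsmul, hqP, hMP, zsmul_zero, zsmul_zero, add_zero]

end Law

/-! ## §2 Displayed local structure -/

section Structure

variable {K : Type} [Field K] [NumberField K] (W : WeierstrassCurve K) [W.IsElliptic] (M : ℕ)
variable (e : W.geomTorsion ((2 ^ M : ℕ) : ℤ) → W.geomTorsion ((2 ^ M : ℕ) : ℤ) → AlgebraicClosure K)
  (hμ : ∀ S T, e S T ^ (2 ^ M) = 1)
  (hadd₁ : ∀ S₁ S₂ T, e (S₁ + S₂) T = e S₁ T * e S₂ T)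
  (hadd₂ : ∀ S T₁ T₂, e S (T₁ + T₂) = e S T₁ * e S T₂)
  (hgal : ∀ (γ : absoluteGaloisGroup K) (S T : W.geomTorsion ((2 ^ M : ℕ) : ℤ)), γ • e S T = e (γ • S) (γ • T))
  (halt : ∀ T, e T T = 1)
  (v : HeightOneSpectrum (𝓞 K)) (inv : LocalInvariants K (2 ^ M))

variable {T : Type*} [AddCommGroup T] (t : T →+ T) (ht : ∀ Q, t (t Q) = Q)
  (σ : galoisCohomology ((W.torsionGaloisModule ((2 ^ M : ℕ) : ℤ)).toLocal (Sum.inr v)) 1 →+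
    galoisCohomology ((W.torsionGaloisModule ((2 ^ M : ℕ) : ℤ)).toLocal (Sum.inr v)) 1)
  (hσ : ∀ X, σ (σ X) = X)
  (hσb : ∀ X Y, invWeilPairing W (2 ^ M) e hμ hadd₁ hadd₂ hgal inv (Sum.inr v) (σ X) (σ Y) =
    invWeilPairing W (2 ^ M) e hμ hadd₁ hadd₂ hgal inv (Sum.inr v) X Y)
  (unr : T →+ galoisCohomology ((W.torsionGaloisModule ((2 ^ M : ℕ) : ℤ)).toLocal (Sum.inr v)) 1)
  (hunr : ∀ Q, unr (t Q) = σ (unr Q))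
  (hLunr : ∀ Y ∈ W.kummerSelmerStructure ((2 ^ M : ℕ) : ℤ) (Sum.inr v), ∃ Q, unr Q = Y)
  (hunr0 : Injective unr)
  (P₁ : T)
  (hspan : ∀ Q : T, ∃ a b : ℤ, Q = a • P₁ + b • t P₁)
  (hfree : ∀ a b : ℤ, a • P₁ + b • t P₁ = 0 → (2 ^ M : ℤ) ∣ a ∧ (2 ^ M : ℤ) ∣ b)
  (htor : (2 ^ M : ℤ) • P₁ = 0)

omit [W.IsElliptic] in
include ht hσ hσb hunr hLunr hunr0 hspan hfree htor in
/-- **Bottom-layer vanishing modulo `q` (displayed structure).**  In the setting of `…RTLocalEigenDuality` §1: for Kummer classes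
`Y, Y₁, Y₂ ∈ 𝓛_v` with `σY − Y = q·Y₁` and `2Y = q·Y₂`, and a local class `X` with `σX = ±X`, `q·X = 0`:  **`inv_v(Y ∪ₑ X) = 0`**.
[cite: McCallumLMS1991, §4 Prop. 4.7, §5 Lemma 5.3] -/
theorem invWeilPairing_kummer_eq_zero_of_conj_sub_eq_zsmul_of_two_smul_eq_zsmul {s q : ℤ} (hs : s = 1 ∨ s = -1)
    {Y Y₁ Y₂ X : galoisCohomology ((W.torsionGaloisModule ((2 ^ M : ℕ) : ℤ)).toLocal (Sum.inr v)) 1}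
    (hY : Y ∈ W.kummerSelmerStructure ((2 ^ M : ℕ) : ℤ) (Sum.inr v)) (hY₁ : Y₁ ∈ W.kummerSelmerStructure ((2 ^ M : ℕ) : ℤ) (Sum.inr v))
    (hY₂ : Y₂ ∈ W.kummerSelmerStructure ((2 ^ M : ℕ) : ℤ) (Sum.inr v))
    (hσY : σ Y - Y = q • Y₁) (h2Y : (2 : ℤ) • Y = q • Y₂) (hX : σ X = s • X) (hqX : q • X = 0) :
    invWeilPairing W (2 ^ M) e hμ hadd₁ hadd₂ hgal inv (Sum.inr v) Y X = 0 := by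
  set b := invWeilPairing W (2 ^ M) e hμ hadd₁ hadd₂ hgal inv (Sum.inr v) with hb
  obtain ⟨w, rfl⟩ := hLunr Y hY
  obtain ⟨w₁, rfl⟩ := hLunr Y₁ hY₁
  obtain ⟨w₂, rfl⟩ := hLunr Y₂ hY₂
  have hw1 : t w - w = q • w₁ := by
    apply hunr0
    rw [map_sub, map_zsmul, hunr, hσY]
  have hw2 : (2 : ℤ) • w = q • w₂ := by
    apply hunr0
    rw [map_zsmul, map_zsmul, h2Y]
  have hinv' : ∀ (x : T) (y : galoisCohomology ((W.torsionGaloisModule ((2 ^ M : ℕ) : ℤ)).toLocal (Sum.inr v)) 1),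
      (b.comp unr) (t x) (σ y) = (b.comp unr) x y := fun x y ↦ by
    rw [AddMonoidHom.comp_apply, AddMonoidHom.comp_apply, hunr, hσb]
  have key := pairing_eq_zero_of_tau_sub_eq_zsmul_of_two_smul_eq_zsmul t ht σ hσ (b.comp unr) hinv' P₁ hspan hfree htor hs hw1 hw2
    hX hqX
  rwa [AddMonoidHom.comp_apply] at key

omit [W.IsElliptic] in
include halt ht hσ hσb hunr hLunr hunr0 hspan hfree htor in
/-- The same with the Kummer class in the second slot: **`inv_v(X ∪ₑ Y) = 0`** (`invWeilPairing_comm`). [cite: McCallumLMS1991, §4 Prop. 4.7] -/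
theorem invWeilPairing_kummer_right_eq_zero_of_conj_sub_eq_zsmul_of_two_smul_eq_zsmul {s q : ℤ} (hs : s = 1 ∨ s = -1)
    {Y Y₁ Y₂ X : galoisCohomology ((W.torsionGaloisModule ((2 ^ M : ℕ) : ℤ)).toLocal (Sum.inr v)) 1}
    (hY : Y ∈ W.kummerSelmerStructure ((2 ^ M : ℕ) : ℤ) (Sum.inr v)) (hY₁ : Y₁ ∈ W.kummerSelmerStructure ((2 ^ M : ℕ) : ℤ) (Sum.inr v))
    (hY₂ : Y₂ ∈ W.kummerSelmerStructure ((2 ^ M : ℕ) : ℤ) (Sum.inr v))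
    (hσY : σ Y - Y = q • Y₁) (h2Y : (2 : ℤ) • Y = q • Y₂) (hX : σ X = s • X) (hqX : q • X = 0) :
    invWeilPairing W (2 ^ M) e hμ hadd₁ hadd₂ hgal inv (Sum.inr v) X Y = 0 := by
  rw [invWeilPairing_comm W M e hμ hadd₁ hadd₂ hgal halt v inv X Y]
  exact invWeilPairing_kummer_eq_zero_of_conj_sub_eq_zsmul_of_two_smul_eq_zsmul W M e hμ hadd₁ hadd₂ hgal v inv t ht σ hσ hσb unr hunr
    hLunr hunr0 P₁ hspan hfree htor hs hY hY₁ hY₂ hσY h2Y hX hqX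

end Structure

/-! ## §3 Assembled at a deep inert Kolyvagin place of the Heegner field -/

section Kolyvagin

variable (W : WeierstrassCurve ℚ) (K : Type) [Field K] [NumberField K] [W.IsElliptic] [W.IsGloballyMinimal]

/-- **BOTTOM-LAYER VANISHING AT A DEEP INERT KOLYVAGIN PLACE, modulo `q` (assembled).**  `K` imaginary quadratic, `τ ≠ 1`, `τ² = 1`; `E/ℚ`
globally minimal, `Δ < 0`; `ℓ` Zhang–Kolyvagin at `2` with `1 ≤ M ≤ M(ℓ)`, `FrobEqFrobInfty W K (2^M) ℓ`; `λ ∋ ℓ`, `τ•λ = λ`; `e` lift-equivariant,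
`inv` conj-compatible.  For a GLOBAL class `x` with `τ_* x = ±x` whose localisation is killed by `q`, and LOCAL Kummer classes
`Y, Y₁, Y₂ ∈ 𝓛_λ` with `σ_*Y − Y = q·Y₁`, `2Y = q·Y₂`:  **`inv_λ(Y ∪ₑ loc_λ x) = 0` and `inv_λ(loc_λ x ∪ₑ Y) = 0`.**
[cite: McCallumLMS1991, §4 Prop. 4.7, §5 Lemma 5.3] [cite: GrossLMS1991, §3 (3.2)] -/
theorem invWeilPairing_kummer_localization_eq_zero_of_conjActPlace_sub_eq_zsmul_of_two_smul (hK : IsImaginaryQuadratic K)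
    (hΔ : W.Δ < 0) {M ℓ : ℕ} (hM : 1 ≤ M)
    (hℓ : Zhang2014.IsKolyvaginPrime (W.conductorNorm ℤ) W K 2 ℓ) (hk : M ≤ Zhang2014.kolyvaginIndex W 2 ℓ)
    (hF : FrobEqFrobInfty W K (2 ^ M) ℓ) (w : HeightOneSpectrum (𝓞 K)) (hw : (ℓ : 𝓞 K) ∈ w.asIdeal)
    {τ : K ≃ₐ[ℚ] K} (hτ1 : τ ≠ 1) (hττ : τ * τ = 1) (hfix : τ • w = w)
    (e : (W.baseChange K).geomTorsion ((2 ^ M : ℕ) : ℤ) → (W.baseChange K).geomTorsion ((2 ^ M : ℕ) : ℤ) → AlgebraicClosure K)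
    (hμ : ∀ S T, e S T ^ (2 ^ M) = 1)
    (hadd₁ : ∀ S₁ S₂ T, e (S₁ + S₂) T = e S₁ T * e S₂ T)
    (hadd₂ : ∀ S T₁ T₂, e S (T₁ + T₂) = e S T₁ * e S T₂)
    (hgal : ∀ (γ : absoluteGaloisGroup K) (S T : (W.baseChange K).geomTorsion ((2 ^ M : ℕ) : ℤ)), γ • e S T = e (γ • S) (γ • T))
    (halt : ∀ T, e T T = 1)
    (hte : ∀ S T, e ((isLiftOfAut_liftAutPlace τ hfix).torsionMap W ((2 ^ M : ℕ) : ℤ) S)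
      ((isLiftOfAut_liftAutPlace τ hfix).torsionMap W ((2 ^ M : ℕ) : ℤ) T) = liftAutPlace τ hfix (e S T))
    (inv : LocalInvariants K (2 ^ M)) (hinvc : inv.IsConjCompatible τ)
    {x : galoisCohomology ((W.baseChange K).torsionGaloisModule ((2 ^ M : ℕ) : ℤ)) 1} {s q : ℤ} (hs : s = 1 ∨ s = -1)
    (hx : conjAct W τ ((2 ^ M : ℕ) : ℤ) x = s • x)
    (hqx : q • galoisCohomology.localization ((W.baseChange K).torsionGaloisModule ((2 ^ M : ℕ) : ℤ)) (Sum.inr w : Place K) 1 x = 0)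
    {Y Y₁ Y₂ : galoisCohomology (((W.baseChange K).torsionGaloisModule ((2 ^ M : ℕ) : ℤ)).toLocal (Sum.inr w : Place K)) 1}
    (hY : Y ∈ (W.baseChange K).kummerSelmerStructure ((2 ^ M : ℕ) : ℤ) (Sum.inr w))
    (hY₁ : Y₁ ∈ (W.baseChange K).kummerSelmerStructure ((2 ^ M : ℕ) : ℤ) (Sum.inr w))
    (hY₂ : Y₂ ∈ (W.baseChange K).kummerSelmerStructure ((2 ^ M : ℕ) : ℤ) (Sum.inr w))
    (hσY : conjActPlace W τ ((2 ^ M : ℕ) : ℤ) hfix Y - Y = q • Y₁) (h2Y : (2 : ℤ) • Y = q • Y₂) :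
    invWeilPairing (W.baseChange K) (2 ^ M) e hμ hadd₁ hadd₂ hgal inv (Sum.inr w) Y
        (galoisCohomology.localization ((W.baseChange K).torsionGaloisModule ((2 ^ M : ℕ) : ℤ)) (Sum.inr w : Place K) 1 x) = 0 ∧
      invWeilPairing (W.baseChange K) (2 ^ M) e hμ hadd₁ hadd₂ hgal inv (Sum.inr w)
        (galoisCohomology.localization ((W.baseChange K).torsionGaloisModule ((2 ^ M : ℕ) : ℤ)) (Sum.inr w : Place K) 1 x) Y = 0 := by
  set loc := galoisCohomology.localization ((W.baseChange K).torsionGaloisModule ((2 ^ M : ℕ) : ℤ)) (Sum.inr w : Place K) 1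
    with hloc
  set σ := conjActPlace W τ ((2 ^ M : ℕ) : ℤ) hfix with hσdef
  set t := (isLiftOfAut_liftAutPlace τ hfix).torsionMap W ((2 ^ M : ℕ) : ℤ) with htdef
  -- good reduction and `2 ∉ λ`
  obtain ⟨hgood, hpw⟩ := hasGoodReductionAt_of_zhangKolyvaginPrime W K hℓ w hw 1
  have hpw' : ((2 : ℕ) : 𝓞 K) ∉ w.asIdeal := by rwa [pow_one, Int.cast_natCast] at hpw
  -- the `τ`-structure
  have hσ : ∀ X, σ (σ X) = X := fun X ↦ conjActPlace_conjActPlace_self W τ (2 ^ M) hττ hfix X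
  have hσb := invWeilPairing_conjActPlace_self W τ (2 ^ M) e hμ hadd₁ hadd₂ hgal hfix hte inv hinvc
  -- the unramified parametrisation and the regular frame
  obtain ⟨unr, hunr0, -, hLunr, hunr⟩ :=
    exists_unramified_parametrization_kummer W K hK hℓ hk w hw hpw' hgood τ hfix
  obtain ⟨Q₀, htor, hspan, hfree, ht⟩ := exists_regular_frame_liftAutPlace W K hK hΔ hM hℓ hk hF w hw hτ1 hfix
  have hX : σ (loc x) = s • loc x := by
    rw [hσdef, hloc, conjActPlace_localization_self W τ (2 ^ M) hfix x, hx, map_zsmul]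
  have h1 := invWeilPairing_kummer_eq_zero_of_conj_sub_eq_zsmul_of_two_smul_eq_zsmul (W.baseChange K) M e hμ hadd₁ hadd₂ hgal w inv t
    ht σ hσ hσb unr hunr hLunr hunr0 Q₀ hspan hfree htor hs hY hY₁ hY₂ hσY h2Y hX hqx
  exact ⟨h1, by rw [invWeilPairing_comm (W.baseChange K) M e hμ hadd₁ hadd₂ hgal halt w inv]; exact h1⟩

/-- The same at a level `N = 2^M` given as a variable (so that it applies VERBATIM at the Cassels–Tate level `N = m·m`).
[cite: McCallumLMS1991, §4 Prop. 4.7] -/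
theorem invWeilPairing_kummer_localization_eq_zero_of_conjActPlace_sub_eq_zsmul_of_two_smul_of_level_eq {N : ℕ} [NeZero N] {M : ℕ}
    (hN : N = 2 ^ M)
    (hK : IsImaginaryQuadratic K) (hΔ : W.Δ < 0) {ℓ : ℕ} (hM : 1 ≤ M)
    (hℓ : Zhang2014.IsKolyvaginPrime (W.conductorNorm ℤ) W K 2 ℓ) (hk : M ≤ Zhang2014.kolyvaginIndex W 2 ℓ)
    (hF : FrobEqFrobInfty W K (2 ^ M) ℓ) (w : HeightOneSpectrum (𝓞 K)) (hw : (ℓ : 𝓞 K) ∈ w.asIdeal)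
    {τ : K ≃ₐ[ℚ] K} (hτ1 : τ ≠ 1) (hττ : τ * τ = 1) (hfix : τ • w = w)
    (e : (W.baseChange K).geomTorsion ((N : ℕ) : ℤ) → (W.baseChange K).geomTorsion ((N : ℕ) : ℤ) → AlgebraicClosure K)
    (hμ : ∀ S T, e S T ^ N = 1)
    (hadd₁ : ∀ S₁ S₂ T, e (S₁ + S₂) T = e S₁ T * e S₂ T)
    (hadd₂ : ∀ S T₁ T₂, e S (T₁ + T₂) = e S T₁ * e S T₂)
    (hgal : ∀ (γ : absoluteGaloisGroup K) (S T : (W.baseChange K).geomTorsion ((N : ℕ) : ℤ)), γ • e S T = e (γ • S) (γ • T))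
    (halt : ∀ T, e T T = 1)
    (hte : ∀ S T, e ((isLiftOfAut_liftAutPlace τ hfix).torsionMap W ((N : ℕ) : ℤ) S)
      ((isLiftOfAut_liftAutPlace τ hfix).torsionMap W ((N : ℕ) : ℤ) T) = liftAutPlace τ hfix (e S T))
    (inv : LocalInvariants K N) (hinvc : inv.IsConjCompatible τ)
    {x : galoisCohomology ((W.baseChange K).torsionGaloisModule ((N : ℕ) : ℤ)) 1} {s q : ℤ} (hs : s = 1 ∨ s = -1)
    (hx : conjAct W τ ((N : ℕ) : ℤ) x = s • x)
    (hqx : q • galoisCohomology.localization ((W.baseChange K).torsionGaloisModule ((N : ℕ) : ℤ)) (Sum.inr w : Place K) 1 x = 0)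
    {Y Y₁ Y₂ : galoisCohomology (((W.baseChange K).torsionGaloisModule ((N : ℕ) : ℤ)).toLocal (Sum.inr w : Place K)) 1}
    (hY : Y ∈ (W.baseChange K).kummerSelmerStructure ((N : ℕ) : ℤ) (Sum.inr w))
    (hY₁ : Y₁ ∈ (W.baseChange K).kummerSelmerStructure ((N : ℕ) : ℤ) (Sum.inr w))
    (hY₂ : Y₂ ∈ (W.baseChange K).kummerSelmerStructure ((N : ℕ) : ℤ) (Sum.inr w))
    (hσY : conjActPlace W τ ((N : ℕ) : ℤ) hfix Y - Y = q • Y₁) (h2Y : (2 : ℤ) • Y = q • Y₂) :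
    invWeilPairing (W.baseChange K) N e hμ hadd₁ hadd₂ hgal inv (Sum.inr w) Y
        (galoisCohomology.localization ((W.baseChange K).torsionGaloisModule ((N : ℕ) : ℤ)) (Sum.inr w : Place K) 1 x) = 0 ∧
      invWeilPairing (W.baseChange K) N e hμ hadd₁ hadd₂ hgal inv (Sum.inr w)
        (galoisCohomology.localization ((W.baseChange K).torsionGaloisModule ((N : ℕ) : ℤ)) (Sum.inr w : Place K) 1 x) Y = 0 := by
  subst hN
  exact invWeilPairing_kummer_localization_eq_zero_of_conjActPlace_sub_eq_zsmul_of_two_smul W K hK hΔ hM hℓ hk hF w hw hτ1 hττ hfix e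
    hμ hadd₁ hadd₂ hgal halt hte inv hinvc hs hx hqx hY hY₁ hY₂ hσY h2Y

end Kolyvagin

end Summit.BirchSwinnertonDyer.BirchSwinnertonDyer.Theorems.GenusExact.PlusDescent

end
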